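import Summits.ResolutionOfSingularities.ResolutionOfSingularities.Theorems.FrobeniusLadderFInjectiveMacaulayficationFullLastCentreBedCInstance
import Summits.ResolutionOfSingularities.ResolutionOfSingularities.Theorems.FrobeniusLadderFInjectiveMacaulayficationFullLastCentreAxisOrder
import Summits.ResolutionOfSingularities.ResolutionOfSingularities.Theorems.FrobeniusLadderFInjectiveMacaulayficationFullLastCentreResidual
import HarnessLib

/-!
# THE ONE-STEP DOOR `MC8cOneStep CoordCanonical` (`OneStepCoordProxy`) IS FALSE: `ρ′ = 9` AT A COORDINATE-CANONICAL CURVE CENTRE — KERNEL NEGATIVE (instance bed 178, every hypothesis certified)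
# (crux `FInjectiveMacaulayfication` stmt-ResolutionOfSingularities-15315, chain w45a; res-L1-w45a-plan-1 RULING R26.13 (d) «stub-1 standby `not_mc8cOneStep_coordCanonical` … it closes the cc
# one-step door in the kernel as BedC closed (LC)», R26.1 (B1); record = one of the two «canonlast ρ = 9» records of res-L1-w45a-lead-1 g16ʼs kit M-g16-1 (job j332890, `sweep.json` sha16
# ffa7fb8a74bdd625): bed 178 (generator `sqpert`, seed 1; FULL at p = 11), pattern [P y₄; C(axis y₃; dir y₂); C(axis y₃; dir e₀); C(axis e₂; dir y₁)], replayed with res-L1-w45a-lead-1ʼs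
# `dropdatum` chain semantics and re-verified on an independent engine (res-L1-w45a-stub-1 g17 `g17-onestep/verify2.py`, exact ℚ, GF(11), GF(13)); definitions = res-L1-w45a-lead-1 ✓p727906
# `FullLastCentreDefs`, exact law ✓p729098 `FullLastCentreAxisOrder`, ✓p729821 `FullLastCentreResidual`; tools = res-L1-w45a-stub-1 ✓p729709 `FullLastCentreKitTools` (+ `tdeg_eq` of ✓p730359); seat res-L1-w45a-stub-1 g17)

[OURS · L1 W4.5a] Support file (`--supports stmt-ResolutionOfSingularities-15315 --as helper`); DATA definitions (term lists, exact integers) + theorems; no named fact; NOT a statement of any manuscript;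
nothing of the crux is proved — an INTERMEDIATE typed door of the T-side (the history-free one-step form of MC-8ᶜ under COORDINATE canonicity, `Lines/T_canon_door.lean` §3 `MC8cOneStep` with
`Canon := CoordCanonical`) is REFUTED by an explicit instance. NOT refuted: `MC8cOneStep TopLocusIs` (door candidate #1 of record, R26.13 (b): ideal-theoretic canonicity FAILS at this centre —
two triple axes through `x₃`, evidence level) and the chain-level `MC8cChain`. AI-written (AI review is weaker than expert review).

THE INSTANCE (letters `(y₁, e₁, y₃, e₂) = Letter 0, 1, 2, 3`: `y₁, y₃` original letters, `e₁, e₂` the exceptional letters created at steps 1 and 2; field: ANY `K` of characteristic 11; the data are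
exact integers and the same certificates pass at `p = 0` and `p = 13`, evidence level). Stage `S` = the origin `x₃` after [P y₄; C(y₃-axis; y₂); C(y₃-axis; e₀)]: monic cubic `x³ + b₂x² + b₁x + b₀`
(`b₂, b₁, b₀` with 3 / 4 / 9 monomials, §1), `Exc = {e₁, e₂}`, signed defects `d_{e₁} = 1`, `d_{e₂} = 2`; centre `Z` = the `e₂`-AXIS `V(x, y₁, e₁, y₃)`, i.e. `Nor = {0, 1, 2}` (a CURVE), direction
`L = y₁ = 0`; `S′` = the `y₁`-chart origin of `Bl_Z` (`Exc′ = {y₁, e₁, e₂}`, `d′_{y₁} = (|Nor| + 1 − 4) + d_{e₁} = 1`). Residual decomposition at `S`: `α = 0`, `N = Disc_x(S)` (113 monomials; prime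
to `e₁` and `e₂`).
CERTIFIED (§3–§4): `Nor.Nonempty`, `Nor ≠ univ`, `L ∈ Nor`, `Permissible S Nor`, `CoordCanonical S Nor` (witnesses `x²y₁`, `e₁³e₂⁶ ∈ supp b₀`, `x²y₃`), `Budgeted S` (ONE monomial `x·y₁e₁y₃e₂²` for
all weights), `IsChart S Nor L S′` (three `chartNF` certificates), `IsDropPoint S′` (`b₂′(0) = −1`), `Budgeted S′` (`x·y₃`), `IsResidual S.Exc S.D 0 N` (the discriminant identity, one
`decide +kernel`), `ν = 6` EXACTLY (§5), and by the exact law ✓ `ordLE_iff`: for EVERY residual decomposition `Disc_x(S′) = y^{α′}N′` (they exist, ✓ `exists_isResidual`):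
★★ `OrdLE N′ 9 ∧ ¬ OrdLE N′ 8`, i.e. **`ρ′ = 9 > 8`** (`e₀ + 2e₁ + 2e₂ + e₃ ≥ 15` on all 113 monomials, `= 15` at `4·y₁³y₃⁶`). Hence ★★★ `counterexample` and ★★★ `not_mc8cOneStep_coordCanonical`:
the ∀-statement `MC8cOneStep CoordCanonical` of `Lines/T_canon_door.lean` §3 (restated VERBATIM) is FALSE. Bonus (§5): the cone-initial order is exactly 9 here (`AxisOrdLE … 9 ∧ ¬ … 8`), a
second — curve-centre — counterexample to the already refuted cut (LC). [folklore computation]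
-/

-- single-problem summit: the doubled namespace component is forced
set_option linter.dupNamespace false

noncomputable section

open MvPolynomial Finsupp

namespace Summit.ResolutionOfSingularities.ResolutionOfSingularities.Theorems.FInjectiveMacaulayfication.LastCentreBed178

open Summit.ResolutionOfSingularities.ResolutionOfSingularities.Theorems.FInjectiveMacaulayfication LastCentreDefs KLocCellKit LastCentreKit

/-! ## §1 The data (term lists `(coefficient, exponent vector)`; exact integer coefficients of the kit record) -/

/-- `b₂` of stage `S` (coefficient of `x²`; 3 monomials; exact integers). [data; kit j332890 record bed 178] -/
def b2L : List (ℤ × (Fin 4 → ℕ)) :=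
  [((-2 : ℤ), (![0, 0, 1, 0] : Fin 4 → ℕ)), ((-1 : ℤ), (![1, 0, 0, 0] : Fin 4 → ℕ)), ((-1 : ℤ), (![1, 1, 0, 2] : Fin 4 → ℕ))]

/-- `b₁` of stage `S` (4 monomials). [data] -/
def b1L : List (ℤ × (Fin 4 → ℕ)) :=
  [((1 : ℤ), (![0, 0, 2, 0] : Fin 4 → ℕ)), ((2 : ℤ), (![1, 0, 1, 0] : Fin 4 → ℕ)), ((2 : ℤ), (![1, 1, 1, 2] : Fin 4 → ℕ)), ((1 : ℤ), (![1, 3, 2, 5] : Fin 4 → ℕ))]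

/-- `b₀` of stage `S` (9 monomials). [data] -/
def b0L : List (ℤ × (Fin 4 → ℕ)) :=
  [((1 : ℤ), (![0, 0, 6, 0] : Fin 4 → ℕ)), ((2 : ℤ), (![0, 3, 0, 6] : Fin 4 → ℕ)), ((7 : ℤ), (![0, 10, 0, 12] : Fin 4 → ℕ)), ((-1 : ℤ), (![1, 0, 2, 0] : Fin 4 → ℕ)), ((-1 : ℤ), (![1, 1, 2, 2] : Fin 4 → ℕ)), ((2 : ℤ), (![1, 3, 5, 5] : Fin 4 → ℕ)),
   ((2 : ℤ), (![2, 2, 1, 4] : Fin 4 → ℕ)), ((3 : ℤ), (![3, 3, 0, 6] : Fin 4 → ℕ)), ((5 : ℤ), (![6, 6, 0, 12] : Fin 4 → ℕ))]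

/-- `b₂′` of stage `S′` (the `y₁`-chart origin of `Bl_Z`; 3 monomials). [data] -/
def b2L' : List (ℤ × (Fin 4 → ℕ)) :=
  [((-1 : ℤ), (![0, 0, 0, 0] : Fin 4 → ℕ)), ((-2 : ℤ), (![0, 0, 1, 0] : Fin 4 → ℕ)), ((-1 : ℤ), (![1, 1, 0, 2] : Fin 4 → ℕ))]

/-- `b₁′` (4 monomials). [data] -/
def b1L' : List (ℤ × (Fin 4 → ℕ)) :=
  [((2 : ℤ), (![0, 0, 1, 0] : Fin 4 → ℕ)), ((1 : ℤ), (![0, 0, 2, 0] : Fin 4 → ℕ)), ((2 : ℤ), (![1, 1, 1, 2] : Fin 4 → ℕ)), ((1 : ℤ), (![4, 3, 2, 5] : Fin 4 → ℕ))]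

/-- `b₀′` (9 monomials). [data] -/
def b0L' : List (ℤ × (Fin 4 → ℕ)) :=
  [((-1 : ℤ), (![0, 0, 2, 0] : Fin 4 → ℕ)), ((2 : ℤ), (![0, 3, 0, 6] : Fin 4 → ℕ)), ((-1 : ℤ), (![1, 1, 2, 2] : Fin 4 → ℕ)), ((2 : ℤ), (![2, 2, 1, 4] : Fin 4 → ℕ)), ((1 : ℤ), (![3, 0, 6, 0] : Fin 4 → ℕ)), ((3 : ℤ), (![3, 3, 0, 6] : Fin 4 → ℕ)),
   ((2 : ℤ), (![6, 3, 5, 5] : Fin 4 → ℕ)), ((7 : ℤ), (![7, 10, 0, 12] : Fin 4 → ℕ)), ((5 : ℤ), (![9, 6, 0, 12] : Fin 4 → ℕ))]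

/-- The residual `N = Disc_x(S)` itself (`α = 0`; 113 monomials, exact integers; two of them vanish mod 11). [data] -/
def NL : List (ℤ × (Fin 4 → ℕ)) :=
  [((-4 : ℤ), (![0, 0, 9, 0] : Fin 4 → ℕ)), ((-27 : ℤ), (![0, 0, 12, 0] : Fin 4 → ℕ)), ((-8 : ℤ), (![0, 3, 3, 6] : Fin 4 → ℕ)), ((-108 : ℤ), (![0, 3, 6, 6] : Fin 4 → ℕ)), ((-108 : ℤ), (![0, 6, 0, 12] : Fin 4 → ℕ)), ((-28 : ℤ), (![0, 10, 3, 12] : Fin 4 → ℕ)),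
   ((-378 : ℤ), (![0, 10, 6, 12] : Fin 4 → ℕ)), ((-756 : ℤ), (![0, 13, 0, 18] : Fin 4 → ℕ)), ((-1323 : ℤ), (![0, 20, 0, 24] : Fin 4 → ℕ)), ((12 : ℤ), (![1, 0, 8, 0] : Fin 4 → ℕ)), ((12 : ℤ), (![1, 1, 8, 2] : Fin 4 → ℕ)), ((24 : ℤ), (![1, 3, 2, 6] : Fin 4 → ℕ)),
   ((-4 : ℤ), (![1, 3, 6, 5] : Fin 4 → ℕ)), ((-8 : ℤ), (![1, 3, 8, 5] : Fin 4 → ℕ)), ((-36 : ℤ), (![1, 3, 9, 5] : Fin 4 → ℕ)), ((-108 : ℤ), (![1, 3, 11, 5] : Fin 4 → ℕ)), ((24 : ℤ), (![1, 4, 2, 8] : Fin 4 → ℕ)), ((-72 : ℤ), (![1, 6, 3, 11] : Fin 4 → ℕ)),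
   ((-216 : ℤ), (![1, 6, 5, 11] : Fin 4 → ℕ)), ((84 : ℤ), (![1, 10, 2, 12] : Fin 4 → ℕ)), ((84 : ℤ), (![1, 11, 2, 14] : Fin 4 → ℕ)), ((-252 : ℤ), (![1, 13, 3, 17] : Fin 4 → ℕ)), ((-756 : ℤ), (![1, 13, 5, 17] : Fin 4 → ℕ)), ((-12 : ℤ), (![2, 0, 7, 0] : Fin 4 → ℕ)),
   ((-24 : ℤ), (![2, 1, 7, 2] : Fin 4 → ℕ)), ((-8 : ℤ), (![2, 2, 4, 4] : Fin 4 → ℕ)), ((-120 : ℤ), (![2, 2, 7, 4] : Fin 4 → ℕ)), ((-24 : ℤ), (![2, 3, 1, 6] : Fin 4 → ℕ)), ((12 : ℤ), (![2, 3, 5, 5] : Fin 4 → ℕ)), ((24 : ℤ), (![2, 3, 7, 5] : Fin 4 → ℕ)),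
   ((-18 : ℤ), (![2, 3, 8, 5] : Fin 4 → ℕ)), ((-48 : ℤ), (![2, 4, 1, 8] : Fin 4 → ℕ)), ((12 : ℤ), (![2, 4, 5, 7] : Fin 4 → ℕ)), ((24 : ℤ), (![2, 4, 7, 7] : Fin 4 → ℕ)), ((-18 : ℤ), (![2, 4, 8, 7] : Fin 4 → ℕ)), ((-240 : ℤ), (![2, 5, 1, 10] : Fin 4 → ℕ)),
   ((-36 : ℤ), (![2, 6, 2, 11] : Fin 4 → ℕ)), ((-8 : ℤ), (![2, 6, 6, 10] : Fin 4 → ℕ)), ((-72 : ℤ), (![2, 6, 8, 10] : Fin 4 → ℕ)), ((-108 : ℤ), (![2, 6, 10, 10] : Fin 4 → ℕ)), ((-36 : ℤ), (![2, 7, 2, 13] : Fin 4 → ℕ)), ((-84 : ℤ), (![2, 10, 1, 12] : Fin 4 → ℕ)),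
   ((-168 : ℤ), (![2, 11, 1, 14] : Fin 4 → ℕ)), ((-840 : ℤ), (![2, 12, 1, 16] : Fin 4 → ℕ)), ((-126 : ℤ), (![2, 13, 2, 17] : Fin 4 → ℕ)), ((-126 : ℤ), (![2, 14, 2, 19] : Fin 4 → ℕ)), ((4 : ℤ), (![3, 0, 6, 0] : Fin 4 → ℕ)), ((12 : ℤ), (![3, 1, 6, 2] : Fin 4 → ℕ)),
   ((24 : ℤ), (![3, 2, 3, 4] : Fin 4 → ℕ)), ((12 : ℤ), (![3, 2, 6, 4] : Fin 4 → ℕ)), ((8 : ℤ), (![3, 3, 0, 6] : Fin 4 → ℕ)), ((12 : ℤ), (![3, 3, 3, 6] : Fin 4 → ℕ)), ((-12 : ℤ), (![3, 3, 4, 5] : Fin 4 → ℕ)), ((-24 : ℤ), (![3, 3, 6, 5] : Fin 4 → ℕ)),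
   ((-158 : ℤ), (![3, 3, 6, 6] : Fin 4 → ℕ)), ((24 : ℤ), (![3, 4, 0, 8] : Fin 4 → ℕ)), ((-24 : ℤ), (![3, 4, 4, 7] : Fin 4 → ℕ)), ((-48 : ℤ), (![3, 4, 6, 7] : Fin 4 → ℕ)), ((24 : ℤ), (![3, 5, 0, 10] : Fin 4 → ℕ)), ((-84 : ℤ), (![3, 5, 4, 9] : Fin 4 → ℕ)),
   ((-240 : ℤ), (![3, 5, 6, 9] : Fin 4 → ℕ)), ((-316 : ℤ), (![3, 6, 0, 12] : Fin 4 → ℕ)), ((-20 : ℤ), (![3, 6, 5, 10] : Fin 4 → ℕ)), ((-36 : ℤ), (![3, 6, 7, 10] : Fin 4 → ℕ)), ((-20 : ℤ), (![3, 7, 5, 12] : Fin 4 → ℕ)), ((-36 : ℤ), (![3, 7, 7, 12] : Fin 4 → ℕ)),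
   ((-4 : ℤ), (![3, 9, 6, 15] : Fin 4 → ℕ)), ((28 : ℤ), (![3, 10, 0, 12] : Fin 4 → ℕ)), ((84 : ℤ), (![3, 11, 0, 14] : Fin 4 → ℕ)), ((84 : ℤ), (![3, 12, 0, 16] : Fin 4 → ℕ)), ((-1106 : ℤ), (![3, 13, 0, 18] : Fin 4 → ℕ)), ((-24 : ℤ), (![4, 2, 2, 4] : Fin 4 → ℕ)),
   ((-12 : ℤ), (![4, 3, 2, 6] : Fin 4 → ℕ)), ((4 : ℤ), (![4, 3, 3, 5] : Fin 4 → ℕ)), ((8 : ℤ), (![4, 3, 5, 5] : Fin 4 → ℕ)), ((-96 : ℤ), (![4, 4, 2, 8] : Fin 4 → ℕ)), ((12 : ℤ), (![4, 4, 3, 7] : Fin 4 → ℕ)), ((24 : ℤ), (![4, 4, 5, 7] : Fin 4 → ℕ)),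
   ((-24 : ℤ), (![4, 5, 3, 9] : Fin 4 → ℕ)), ((24 : ℤ), (![4, 5, 5, 9] : Fin 4 → ℕ)), ((-140 : ℤ), (![4, 6, 3, 11] : Fin 4 → ℕ)), ((1 : ℤ), (![4, 6, 4, 10] : Fin 4 → ℕ)), ((-316 : ℤ), (![4, 6, 5, 11] : Fin 4 → ℕ)), ((2 : ℤ), (![4, 7, 4, 12] : Fin 4 → ℕ)),
   ((1 : ℤ), (![4, 8, 4, 14] : Fin 4 → ℕ)), ((8 : ℤ), (![5, 2, 1, 4] : Fin 4 → ℕ)), ((-12 : ℤ), (![5, 3, 1, 6] : Fin 4 → ℕ)), ((-48 : ℤ), (![5, 4, 1, 8] : Fin 4 → ℕ)), ((-352 : ℤ), (![5, 5, 1, 10] : Fin 4 → ℕ)), ((-54 : ℤ), (![5, 6, 2, 11] : Fin 4 → ℕ)),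
   ((-54 : ℤ), (![5, 7, 2, 13] : Fin 4 → ℕ)), ((12 : ℤ), (![6, 3, 0, 6] : Fin 4 → ℕ)), ((36 : ℤ), (![6, 4, 0, 8] : Fin 4 → ℕ)), ((36 : ℤ), (![6, 5, 0, 10] : Fin 4 → ℕ)), ((-231 : ℤ), (![6, 6, 0, 12] : Fin 4 → ℕ)), ((-20 : ℤ), (![6, 6, 3, 12] : Fin 4 → ℕ)),
   ((-270 : ℤ), (![6, 6, 6, 12] : Fin 4 → ℕ)), ((-540 : ℤ), (![6, 9, 0, 18] : Fin 4 → ℕ)), ((-1890 : ℤ), (![6, 16, 0, 24] : Fin 4 → ℕ)), ((60 : ℤ), (![7, 6, 2, 12] : Fin 4 → ℕ)), ((60 : ℤ), (![7, 7, 2, 14] : Fin 4 → ℕ)), ((-180 : ℤ), (![7, 9, 3, 17] : Fin 4 → ℕ)),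
   ((-540 : ℤ), (![7, 9, 5, 17] : Fin 4 → ℕ)), ((-60 : ℤ), (![8, 6, 1, 12] : Fin 4 → ℕ)), ((-120 : ℤ), (![8, 7, 1, 14] : Fin 4 → ℕ)), ((-600 : ℤ), (![8, 8, 1, 16] : Fin 4 → ℕ)), ((-90 : ℤ), (![8, 9, 2, 17] : Fin 4 → ℕ)), ((-90 : ℤ), (![8, 10, 2, 19] : Fin 4 → ℕ)),
   ((20 : ℤ), (![9, 6, 0, 12] : Fin 4 → ℕ)), ((60 : ℤ), (![9, 7, 0, 14] : Fin 4 → ℕ)), ((60 : ℤ), (![9, 8, 0, 16] : Fin 4 → ℕ)), ((-790 : ℤ), (![9, 9, 0, 18] : Fin 4 → ℕ)), ((-675 : ℤ), (![12, 12, 0, 24] : Fin 4 → ℕ))]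

/-! ## §2 The stages, the centre, the residual decomposition -/

variable (K : Type) [Field K]

/-- Stage `S` (bed 178 at `x₃`): `Exc = {e₁, e₂}`, `d_{e₁} = 1`, `d_{e₂} = 2`. [data] -/
def S : Stage K := ⟨evalL K b2L, evalL K b1L, evalL K b0L, {1, 3}, fun n => if n = 1 then 1 else if n = 3 then 2 else 0⟩

/-- Stage `S′` (the `y₁`-chart origin of the blow-up of the `e₂`-axis): `Exc′ = {y₁, e₁, e₂}`, `d′_{y₁} = 1`, `d′_{e₁} = 1`, `d′_{e₂} = 2`. [data] -/
def S' : Stage K := ⟨evalL K b2L', evalL K b1L', evalL K b0L', {0, 1, 3}, fun n => if n = 0 then 1 else if n = 1 then 1 else if n = 3 then 2 else 0⟩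

/-- The centre `Z = V(x, y₁, e₁, y₃)` (the `e₂`-axis, a curve): normal letters `{0, 1, 2}`. [data] -/
def Nor : Finset Letter := {0, 1, 2}

/-- The chart direction `L = y₁`. [data] -/
def L : Letter := 0

/-- The exceptional part of `Disc_x(S)` is trivial: `α = 0`. [data] -/
def α : Expo := 0

/-- The residual `N = Disc_x(S)` as a polynomial. [data] -/
def N : YPoly K := evalL K NL

/-! ## §3 The hypotheses of the one-step door at the instance -/

section Instance

variable {K}

/-- `norDeg {0,1,2} e = e 0 + e 1 + e 2`. [plumbing] -/
theorem norDeg_nor (e : Expo) : norDeg Nor e = e 0 + e 1 + e 2 := by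
  simp [norDeg, Nor, add_assoc]

variable (K)

/-- `Nor` is non-empty, proper (the centre is a curve), and contains `L`. [plumbing] -/
theorem nor_facts : (Nor).Nonempty ∧ Nor ≠ Finset.univ ∧ L ∈ Nor := ⟨⟨0, by simp [Nor]⟩, by decide, by simp [Nor, L]⟩

/-- PERMISSIBLE: `X₃` is normally flat of multiplicity 3 along the `e₂`-axis (`bᵢ ∈ I_Z^{3−i}`, checked on the three supports). [OURS · certificate] -/
theorem permissible : Permissible (S K) Nor := by
  refine ⟨fun e he => ?_, fun e he => ?_, fun e he => ?_⟩
  · have h := forall_support_of_list (K := K) b2L (fun v => 1 ≤ v 0 + v 1 + v 2) (by decide) e he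
    simpa [norDeg_nor] using h
  · have h := forall_support_of_list (K := K) b1L (fun v => 2 ≤ v 0 + v 1 + v 2) (by decide) e he
    simpa [norDeg_nor] using h
  · have h := forall_support_of_list (K := K) b0L (fun v => 3 ≤ v 0 + v 1 + v 2) (by decide) e he
    simpa [norDeg_nor] using h

/-- COORDINATE CANONICITY (the kitʼs `canon_last`): none of the three coordinate surfaces through the `e₂`-axis is a triple surface — witnesses `x²·y₁ ∈ b₂x²` (vs `V(x, e₁, y₃)`),
`e₁³e₂⁶ ∈ b₀` (vs `V(x, y₁, y₃)`), `x²·y₃` (vs `V(x, y₁, e₁)`). [OURS · certificate] -/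
theorem coordCanonical [CharP K 11] : CoordCanonical (S K) Nor := by
  intro n₀ hn₀ _ hperm
  simp only [Nor, Finset.mem_insert, Finset.mem_singleton] at hn₀
  rcases hn₀ with rfl | rfl | rfl
  · rw [show (Nor).erase 0 = ({1, 2} : Finset Letter) from by decide] at hperm
    have hmem : Finsupp.equivFunOnFinite.symm (![1, 0, 0, 0] : Fin 4 → ℕ) ∈ (S K).b₂.support :=
      mem_support_evalL_of_not_dvd 11 b2L _ (by decide)
    have h := hperm.1 _ hmem
    simp [norDeg] at h
  · rw [show (Nor).erase 1 = ({0, 2} : Finset Letter) from by decide] at hperm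
    have hmem : Finsupp.equivFunOnFinite.symm (![0, 3, 0, 6] : Fin 4 → ℕ) ∈ (S K).b₀.support :=
      mem_support_evalL_of_not_dvd 11 b0L _ (by decide)
    have h := hperm.2.2 _ hmem
    simp [norDeg] at h
  · rw [show (Nor).erase 2 = ({0, 1} : Finset Letter) from by decide] at hperm
    have hmem : Finsupp.equivFunOnFinite.symm (![0, 0, 1, 0] : Fin 4 → ℕ) ∈ (S K).b₂.support :=
      mem_support_evalL_of_not_dvd 11 b2L _ (by decide)
    have h := hperm.1 _ hmem
    simp [norDeg] at h

/-- DROP POINT at `S′`: `b₂′(0) = −1 ≠ 0`, `b₁′(0) = 0`, `ord b₀′ ≥ 2`. [OURS · certificate] -/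
theorem isDropPoint [CharP K 11] : IsDropPoint (S' K) := by
  refine ⟨?_, ?_, fun e he => ?_⟩
  · rw [show (S' K).b₂ = evalL K b2L' from rfl, coeff_zero_evalL,
      show (((b2L'.filter fun t : ℤ × (Fin 4 → ℕ) => t.2 = 0).map fun t : ℤ × (Fin 4 → ℕ) => t.1).sum : ℤ) = -1 from by decide, Int.cast_neg, Int.cast_one]
    exact neg_ne_zero.mpr one_ne_zero
  · rw [show (S' K).b₁ = evalL K b1L' from rfl, coeff_zero_evalL,
      show (((b1L'.filter fun t : ℤ × (Fin 4 → ℕ) => t.2 = 0).map fun t : ℤ × (Fin 4 → ℕ) => t.1).sum : ℤ) = 0 from by decide, Int.cast_zero]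
  · have h := forall_support_of_list (K := K) b0L' (fun v => 2 ≤ v 0 + v 1 + v 2 + v 3) (by decide) e he
    simpa [LastCentreBedC.tdeg_eq] using h

/-- BUDGET at `S`: the monomial `x·y₁e₁y₃e₂²` of `b₁x` dominates every weight: `wx + w₀ + w₁ + w₂ + 2w₃ ≤ wx + Σw + (1·w₁ + 2·w₃)`. [OURS · certificate] -/
theorem budgeted_S [CharP K 11] : Budgeted (S K) := by
  intro wx w
  right
  refine ⟨1, Finsupp.equivFunOnFinite.symm (![1, 1, 1, 2] : Fin 4 → ℕ), ?_, ?_⟩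
  · simp only [Matrix.cons_val_one]
    exact mem_support_evalL_of_not_dvd 11 b1L _ (by decide)
  · simp [S, Fin.sum_univ_four]
    omega

/-- BUDGET at `S′`: the monomial `x·y₃` of `b₁′x` dominates every weight. [OURS · certificate] -/
theorem budgeted_S' [CharP K 11] : Budgeted (S' K) := by
  intro wx w
  right
  refine ⟨1, Finsupp.equivFunOnFinite.symm (![0, 0, 1, 0] : Fin 4 → ℕ), ?_, ?_⟩
  · simp only [Matrix.cons_val_one]
    exact mem_support_evalL_of_not_dvd 11 b1L' _ (by decide)
  · simp [S', Fin.sum_univ_four, Finset.sum_insert]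
    omega

/-- The residual-decomposition side conditions: `α = 0`, and `N` is prime to `e₁` and `e₂` (witness `4·y₁³y₃⁶`). [OURS · certificate] -/
theorem isResidual_sides [CharP K 11] : (∀ n, n ∉ (S K).Exc → α n = 0) ∧ ∀ n ∈ (S K).Exc, ∃ e ∈ (N K).support, e n = 0 := by
  refine ⟨fun n _ => by simp [α], fun n hn => ?_⟩
  refine ⟨_, mem_support_evalL_of_not_dvd 11 NL (![3, 0, 6, 0] : Fin 4 → ℕ) (by decide), ?_⟩
  simp only [S, Finset.mem_insert, Finset.mem_singleton] at hn
  rcases hn with rfl | rfl <;> simp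

end Instance

/-! ## §4 The polynomial identities through the keyed kit arithmetic (one `decide +kernel` each): the chart transform and the discriminant -/

section Identities

variable {K}

/-- The three chart certificates (data checks). [computational certificate] -/
theorem chartNF_dvd : (∀ t ∈ chartNF Nor L b2L b2L' 1, (11 : ℤ) ∣ t.1) ∧ (∀ t ∈ chartNF Nor L b1L b1L' 2, (11 : ℤ) ∣ t.1) ∧ (∀ t ∈ chartNF Nor L b0L b0L' 3, (11 : ℤ) ∣ t.1) := by
  have h : ((chartNF Nor L b2L b2L' 1).all fun t => decide ((11 : ℤ) ∣ t.1)) = true ∧ ((chartNF Nor L b1L b1L' 2).all fun t => decide ((11 : ℤ) ∣ t.1)) = true ∧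
      ((chartNF Nor L b0L b0L' 3).all fun t => decide ((11 : ℤ) ∣ t.1)) = true := by
    decide +kernel
  simp only [List.all_eq_true, decide_eq_true_eq] at h
  exact h

variable (K) in
/-- IS-CHART: `S′` is the `y₁`-chart origin stage of the blow-up of `S` along the `e₂`-axis — `σ(bᵢ) = y₁^{3−i}bᵢ′` (kernel-checked mod 11), `Exc′ = Exc ∪ {y₁}`,
`d′_{y₁} = (|Nor| + 1 − 4) + d_{e₁} = 1`. [OURS · certificate] -/
theorem isChart [CharP K 11] : IsChart (S K) Nor L (S' K) := by
  refine ⟨?_, ?_, ?_, ?_, fun n hn => ?_, ?_⟩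
  · have h := chart_identity_of_nf (K := K) 11 Nor L b2L b2L' 1 chartNF_dvd.1
    rw [pow_one] at h
    exact h
  · exact chart_identity_of_nf (K := K) 11 Nor L b1L b1L' 2 chartNF_dvd.2.1
  · exact chart_identity_of_nf (K := K) 11 Nor L b0L b0L' 3 chartNF_dvd.2.2
  · simp [S, S', L]
  · have hn' : n ≠ 0 := by simpa [L] using hn
    simp [S, S', hn']
  · simp [S, S', Nor, L]

/-- The keyed computation of `Disc_x(S)`. [certificate data] -/
def discK : List (ℤ × ℕ × (Fin 4 → ℕ)) := discExpr (nk b2L) (nk b1L) (nk b0L)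

variable (K) in
/-- The value of `discK` is `Disc_x(S)`. [plumbing] -/
theorem evalK_discK : evalK K discK = (S K).D := by
  rw [discK, evalK_discExpr, evalK_nk, evalK_nk, evalK_nk]
  rfl

/-- The keyed normal form of `Disc_x(S) − N`. [certificate data] -/
def residualNF : List (ℤ × ℕ × (Fin 4 → ℕ)) :=
  addNFK discK (shiftK ((-1 : ℤ), key (![0, 0, 0, 0] : Fin 4 → ℕ), (![0, 0, 0, 0] : Fin 4 → ℕ)) (nk NL))

/-- The discriminant certificate: all coefficients of `residualNF` vanish (so they do mod 11; the kernel multiplies the `bᵢ` out). [computational certificate] -/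
theorem residualNF_dvd : ∀ t ∈ residualNF, (11 : ℤ) ∣ t.1 := by
  have h : (residualNF.all fun t => decide ((11 : ℤ) ∣ t.1)) = true := by decide +kernel
  simpa only [List.all_eq_true, decide_eq_true_eq] using h

variable (K) in
/-- IS-RESIDUAL: `Disc_x(S) = y^0 · N`, `α = 0`, `N` prime to `e₁`, `e₂`. [OURS · certificate] -/
theorem isResidual [CharP K 11] : IsResidual (S K).Exc (S K).D α (N K) := by
  refine ⟨?_, (isResidual_sides K).1, (isResidual_sides K).2⟩
  have hz := evalK_eq_zero_of_dvd K 11 residualNF residualNF_dvd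
  rw [residualNF, evalK_addNFK, evalK_discK, evalK_shiftK, evalK_nk, Int.cast_neg, Int.cast_one, map_neg, neg_mul] at hz
  have hα : (Finsupp.equivFunOnFinite.symm (![0, 0, 0, 0] : Fin 4 → ℕ) : Fin 4 →₀ ℕ) = α := by
    ext i; fin_cases i <;> simp [α]
  rw [hα] at hz
  rw [N]
  exact (sub_eq_zero.mp (by rw [sub_eq_add_neg]; exact hz))

end Identities

/-! ## §5 `ν = 6`, the cone-initial order is exactly 9, and by the exact law `ρ′ = 9` for every residual decomposition at `S′` -/

section Law

/-- `ν = 6` is attained: `y₁³e₁³e₂⁶ ∈ supp N` has normal degree `6`. [OURS · certificate] -/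
theorem nu_attained [CharP K 11] : ∃ e ∈ (N K).support, norDeg Nor e = 6 :=
  ⟨_, mem_support_evalL_of_not_dvd 11 NL (![3, 3, 0, 6] : Fin 4 → ℕ) (by decide), by rw [norDeg_nor]; simp⟩

/-- Every monomial of `N` has normal degree `≥ 6` along the `e₂`-axis (list check). [OURS · certificate] -/
theorem nu_le : ∀ e ∈ (N K).support, 6 ≤ norDeg Nor e := by
  intro e he
  rw [norDeg_nor]
  exact forall_support_of_list (K := K) NL (fun v => 6 ≤ v 0 + v 1 + v 2) (by decide +kernel) e he

/-- The cone-initial order at `x′` is `≤ 9`: `y₁³e₁³e₂⁶` has minimal normal degree and `|e| − e_{y₁} = 9`. [OURS · certificate] -/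
theorem axisOrdLE_nine [CharP K 11] : AxisOrdLE Nor L (N K) 9 := by
  refine ⟨_, mem_support_evalL_of_not_dvd 11 NL (![3, 3, 0, 6] : Fin 4 → ℕ) (by decide), fun e₁ he₁ => ?_, ?_⟩
  · have h := nu_le K e₁ he₁
    rw [norDeg_nor] at h ⊢
    rw [norDeg_nor]
    simpa using h
  · rw [LastCentreBedC.tdeg_eq, L]
    simp

/-- … and NOT `≤ 8`: every monomial of normal degree `≤ 6` has `|e| − e_{y₁} ≥ 9` (list check) — a second, curve-centre counterexample to the refuted cut (LC). [OURS · certificate] -/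
theorem not_axisOrdLE_eight [CharP K 11] : ¬ AxisOrdLE Nor L (N K) 8 := by
  rintro ⟨e, he, hmin, hle⟩
  have hw : Finsupp.equivFunOnFinite.symm (![3, 3, 0, 6] : Fin 4 → ℕ) ∈ (N K).support :=
    mem_support_evalL_of_not_dvd 11 NL _ (by decide)
  have h1 := hmin _ hw
  rw [norDeg_nor, norDeg_nor] at h1
  simp only [Finsupp.coe_equivFunOnFinite_symm, Matrix.cons_val_zero, Matrix.cons_val_one] at h1
  have h1' : e 0 + e 1 + e 2 ≤ 6 := by simpa using h1
  rw [LastCentreBedC.tdeg_eq, L] at hle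
  have h := forall_support_of_list (K := K) NL (fun v => v 0 + v 1 + v 2 ≤ 6 → 8 + v 0 < v 0 + v 1 + v 2 + v 3) (by decide +kernel) e he h1'
  omega

/-- `N ≠ 0`. [plumbing] -/
theorem N_ne_zero [CharP K 11] : N K ≠ 0 := by
  intro h
  have hw := mem_support_evalL_of_not_dvd (K := K) 11 NL (![3, 0, 6, 0] : Fin 4 → ℕ) (by decide)
  rw [show evalL K NL = N K from rfl, h, MvPolynomial.support_zero] at hw
  simp at hw

/-- `Disc_x(S) = N ≠ 0`. [plumbing] -/
theorem D_ne_zero [CharP K 11] : (S K).D ≠ 0 := by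
  rw [(isResidual K).1]
  exact mul_ne_zero (MvPolynomial.monomial_eq_zero.not.mpr one_ne_zero) (N_ne_zero K)

/-- `Disc_x(S′) ≠ 0` (`σ_L(Disc_x S) = y₁⁶·Disc_x S′`, `σ_L` injective on coefficients). [plumbing] -/
theorem D'_ne_zero [CharP K 11] : (S' K).D ≠ 0 := by
  intro h0
  have hc := LastCentreAxisOrder.disc_chart (isChart K)
  rw [h0, mul_zero] at hc
  apply D_ne_zero K
  ext e
  rw [← LastCentreAxisOrder.coeff_tau_chartMap Nor L (S K).D e, hc, coeff_zero, coeff_zero]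

/-- Residual decompositions `Disc_x(S′) = y^{α′}·N′` w.r.t. `Exc′` exist (✓ `exists_isResidual`). [plumbing] -/
theorem exists_isResidual' [CharP K 11] : ∃ (α' : Expo) (N' : YPoly K), IsResidual (S' K).Exc (S' K).D α' N' :=
  LastCentreResidual.exists_isResidual _ _ (D'_ne_zero K)

/-- `ρ′ ≤ 9`: by ✓ `ordLE_iff`, exhibit `e ∈ supp N` with `|e| + ndeg e ≤ 9 + e_{y₁} + 6`; `4·y₁³y₃⁶` does it (`9 + 9 = 9 + 3 + 6`). [OURS · certificate on ✓p729098] -/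
theorem rho'_le_nine [CharP K 11] {α' : Expo} {N' : YPoly K} (hN' : IsResidual (S' K).Exc (S' K).D α' N') : OrdLE N' 9 := by
  rw [LastCentreAxisOrder.ordLE_iff nor_facts.2.2 (isChart K) (isResidual K) hN' (nu_attained K) (nu_le K) 9]
  refine ⟨_, mem_support_evalL_of_not_dvd 11 NL (![3, 0, 6, 0] : Fin 4 → ℕ) (by decide), ?_⟩
  rw [LastCentreBedC.tdeg_eq, norDeg_nor, L]
  simp

/-- ★★ `¬ ρ′ ≤ 8`: by ✓ `ordLE_iff` this is `|e| + ndeg e > 8 + e_{y₁} + 6`, i.e. `e₀ + 2e₁ + 2e₂ + e₃ ≥ 15`, on every monomial of `N` (list check over the 113 terms). [OURS · certificate on ✓p729098] -/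
theorem not_rho'_le_eight [CharP K 11] {α' : Expo} {N' : YPoly K} (hN' : IsResidual (S' K).Exc (S' K).D α' N') : ¬ OrdLE N' 8 := by
  rw [LastCentreAxisOrder.ordLE_iff nor_facts.2.2 (isChart K) (isResidual K) hN' (nu_attained K) (nu_le K) 8]
  rintro ⟨e, he, hle⟩
  rw [LastCentreBedC.tdeg_eq, norDeg_nor, L] at hle
  have h := forall_support_of_list (K := K) NL (fun v => 8 + v 0 + 6 < v 0 + v 1 + v 2 + v 3 + (v 0 + v 1 + v 2)) (by decide +kernel) e he
  omega

/-- ★★ **`ρ′ = 9` EXACTLY**: residual decompositions at `S′` exist and every one has `ord₀ N′ ≤ 9 ∧ ¬ ord₀ N′ ≤ 8`. [OURS · kernel] -/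
theorem rho'_eq_nine [CharP K 11] :
    (∃ (α' : Expo) (N' : YPoly K), IsResidual (S' K).Exc (S' K).D α' N') ∧
      ∀ (α' : Expo) (N' : YPoly K), IsResidual (S' K).Exc (S' K).D α' N' → OrdLE N' 9 ∧ ¬ OrdLE N' 8 :=
  ⟨exists_isResidual' K, fun _ _ h => ⟨rho'_le_nine K h, not_rho'_le_eight K h⟩⟩

end Law

/-! ## §6 The counterexample and the refutation of the one-step door `MC8cOneStep CoordCanonical` (= `OneStepCoordProxy` of `Lines/T_canon_door.lean` §3) -/

/-- ★★★ **THE COUNTEREXAMPLE**: over every field of characteristic 11 the bed-178 data at the coordinate-canonical `e₂`-axis satisfy EVERY hypothesis of the one-step door (`Nor` non-empty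
(and proper), `L ∈ Nor`, permissible, coordinate-canonical, budgeted, chart, drop point, budgeted, residual at `S`; residual decompositions at `S′` exist) while for EVERY residual decomposition
at `S′` the conclusion `OrdLE N′ 8` FAILS (`ρ′ = 9`). [OURS · kernel negative; res-L1-w45a-plan-1 R26.13 (d)] -/
theorem counterexample (K : Type) [Field K] [CharP K 11] :
    ∃ (S S' : Stage K) (Nor : Finset Letter) (L : Letter) (α : Expo) (N : YPoly K),
      Nor.Nonempty ∧ Nor ≠ Finset.univ ∧ L ∈ Nor ∧ Permissible S Nor ∧ CoordCanonical S Nor ∧ Budgeted S ∧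
        IsChart S Nor L S' ∧ IsDropPoint S' ∧ Budgeted S' ∧ IsResidual S.Exc S.D α N ∧
        (∃ (α' : Expo) (N' : YPoly K), IsResidual S'.Exc S'.D α' N') ∧
        ∀ (α' : Expo) (N' : YPoly K), IsResidual S'.Exc S'.D α' N' → OrdLE N' 9 ∧ ¬ OrdLE N' 8 :=
  ⟨S K, S' K, Nor, L, α, N K, nor_facts.1, nor_facts.2.1, nor_facts.2.2, permissible K, coordCanonical K, budgeted_S K,
    isChart K, isDropPoint K, budgeted_S' K, isResidual K, (rho'_eq_nine K).1, (rho'_eq_nine K).2⟩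

/-- ★★★ **THE ONE-STEP DOOR `MC8cOneStep CoordCanonical` (`OneStepCoordProxy`) IS FALSE** — its ∀-statement, restated VERBATIM from `Lines/T_canon_door.lean` §3 with
`Canon := CoordCanonical`, is refuted by the bed-178 instance over `ZMod 11` (`ρ′ = 9` at a coordinate-canonical CURVE centre on a budgeted stage with a budgeted drop point above it).
NOT refuted: `MC8cOneStep TopLocusIs` (ideal-theoretic canonicity fails at this centre, R26.13) and `MC8cChain`. [OURS · kernel negative; res-L1-w45a-plan-1 R26.13 (d)] -/
theorem not_mc8cOneStep_coordCanonical :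
    ¬ (∀ (k : Type) [Field k] (S S' : Stage k) (Nor : Finset Letter) (L : Letter) (α α' : Expo) (N N' : YPoly k),
        Nor.Nonempty → L ∈ Nor → Permissible S Nor → CoordCanonical S Nor → Budgeted S →
          IsChart S Nor L S' → IsDropPoint S' → Budgeted S' → IsResidual S.Exc S.D α N → IsResidual S'.Exc S'.D α' N' →
            OrdLE N' 8) := by
  intro h
  haveI : Fact (Nat.Prime 11) := ⟨by norm_num⟩
  obtain ⟨α', N', hN'⟩ := exists_isResidual' (ZMod 11)
  exact not_rho'_le_eight (ZMod 11) hN' (h (ZMod 11) (S _) (S' _) Nor L α α' (N _) N' nor_facts.1 nor_facts.2.2 (permissible _)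
    (coordCanonical _) (budgeted_S _) (isChart _) (isDropPoint _) (budgeted_S' _) (isResidual _) hN')

end Summit.ResolutionOfSingularities.ResolutionOfSingularities.Theorems.FInjectiveMacaulayfication.LastCentreBed178

end
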